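import Summits.CriticalPhenomena.PercolationContinuityZ3.Theses.PercTiltedBlockers
import Summits.CriticalPhenomena.PercolationContinuityZ3.Theorems.PercTiltedBlockersWideBoxFromTilt
import Summits.CriticalPhenomena.PercolationContinuityZ3.Theorems.PercTiltedBlockersWideBoxToAnnulus
import Summits.CriticalPhenomena.PercolationContinuityZ3.Theorems.PercTiltedBlockersCrossingTendstoOne
import Summits.CriticalPhenomena.PercolationContinuityZ3.Theorems.PercTiltedBlockersAnnulusAssembly
import HarnessLib

/-!
# Route `PercTiltedBlockers`, item `Assembly` (stmt-CriticalPhenomena-6398)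

Settles the route decl
`Summit.CriticalPhenomena.PercolationContinuityZ3.Theses.PercTiltedBlockers.Assembly`:

  `TiltComparison → CubeBlockingSeed → PercolationContinuityZ3`.

Pure logic over the four support items of the route, all proved in the tree:

* `wideBoxFromTilt_proof` (`WideBoxFromTilt`, stmt-CriticalPhenomena-6396): tilt comparison + cube
  seed ⇒ `P_{p_c}(R(4m; 24m, 24m) blocked) ≥ c > 0` for all `m ≥ 1` (one-scale walk, Tassion 2016 §2
  as template);
* `WideBoxToAnnulus_proof` (`WideBoxToAnnulus`, stmt-CriticalPhenomena-6397): six walls ⇒ the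
  critical annulus-crossing probabilities are `≤ 1 - c`;
* `crossingTendstoOne_proof` (`CrossingTendstoOne`, stmt-CriticalPhenomena-0848): `θ(p) > 0` ⇒
  annulus-crossing probabilities `→ 1`;
* `percTiltedBlockers_annulusAssembly_proof` (`AnnulusAssembly`, stmt-CriticalPhenomena-0847): the
  last two combine to `θ(p_c(ℤ³)) = 0`, i.e. `PercolationContinuityZ3`.

No new definitions; unconditional in the two crux hypotheses (no named-fact hypotheses).

References: G. Grimmett, *Percolation* (1999), §1.4–1.6 [Grimmett1999]; V. Tassion, *Crossing
probabilities for Voronoi percolation*, Ann. Probab. 44 (2016), §2 [Tassion2016].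
-/

namespace Summit.CriticalPhenomena.PercolationContinuityZ3.Theorems

/-- **`Assembly`** of route `PercTiltedBlockers` (item stmt-CriticalPhenomena-6398):
`TiltComparison → CubeBlockingSeed → PercolationContinuityZ3`. Composition of the proved supports
`WideBoxFromTilt`, `WideBoxToAnnulus`, `CrossingTendstoOne`, `AnnulusAssembly`. [folklore] -/
theorem percTiltedBlockers_assembly_proof :
    Summit.CriticalPhenomena.PercolationContinuityZ3.Theses.PercTiltedBlockers.Assembly := by
  unfold Summit.CriticalPhenomena.PercolationContinuityZ3.Theses.PercTiltedBlockers.Assembly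
  intro hTilt hSeed
  exact percTiltedBlockers_annulusAssembly_proof crossingTendstoOne_proof
    (WideBoxToAnnulus_proof (wideBoxFromTilt_proof hTilt hSeed))

end Summit.CriticalPhenomena.PercolationContinuityZ3.Theorems
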